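import Summits.QuantumFields.YangMills.Theorems.BalabanLadderIRcofSchurFejerSplitWindow
import HarnessLib

/-!
# Schur–Fejér splitting — §5c–5e: ★ S2ᵛ FROM ANY SPLIT WINDOW (`splitVanishingAt_of_window`), the cyclic-scalar specialisation and
# the DECOUPLED form (`splitVanishingAt_cyclic_decoupled`, `splitVanishingAt_cyclic`)

Ideator `ym-ir-idea-22` g4 · crux `IRcof` (stmt-QuantumFields-26930) · row 47 stub S2ᵛ; source `Cruxes/IRcof/Lines/equipartition_seam_SchurFejerCore.lean`
rev 7 ∕ 8 §5 (5c–5e, 5d), extracted VERBATIM by the custody LEAD ym-ir-line-ab-p1 g7 (LEAD LANE PROTOCOL (b); critic ym-ir-crit-3 g4 «rev-7 WORD = GO»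
21:54:04Z, K1″–K4″), second of two files under the cap.  ★ `splitVanishingAt_of_window` — for a continuous cover map with finite central kernel, ANY faithful
unitary `ρH` (the cell representation) and ANY split window `W` for `ker π`: the body of S2ᵛ `SplitVanishing` holds (Laplace concentration via
`laplace_ratio_tendsto_zero`; explicit continuous cutoff, no Urysohn; `c(β) := min β (−log q(β)) ∕ β`); (5d) `integral_blind_eq_card_mul_integral_splitW`,
`splitVanishingAt_cyclic_decoupled` (window built on ANY kernel-scalar faithful `ρW`), `splitVanishingAt_cyclic` (the case `ρW = ρH`).
Residue of S2ᵛ as typed (NOT here): existence of a kernel-scalar faithful `ρW` in general, non-cyclic finite central kernels (§6–§7 of the Lines core).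
Same namespace `…EquipartitionSeam.SchurFejer` (K3″: `splitVanishingAt_cyclic`'s docstring carries the honest scope line); proof lane (no definition).
HONEST: one stub of one registered line (row 47, mechanism 0); width 0; YM mass gap (Clay) NOT proved; `IRcof` 0∕1; R4 = `BalabanLadder.UV` only.
-/

set_option autoImplicit false

noncomputable section

open Finset Complex

namespace Summit.QuantumFields.YangMills.Cruxes.IRcof.EquipartitionSeam.SchurFejer

section Laplace

open MeasureTheory Filter Topology
open Literature.MathematicalPhysics.QuantumFieldTheory Literature.MathematicalPhysics.QuantumLattice
open Summit.QuantumFields.YangMills.Theorems.NonSimplyConnectedLatticeGap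
open Literature.RepresentationTheory.CompactGroups (re_sum_conj_mul_nonneg_of_real sum_mul_mul_nonneg_of_complex)
open Literature.Analysis.Matrix (IsPosDefKernel)

variable {G H : Type} [Group G] [TopologicalSpace G] [Group H] [TopologicalSpace H]

/-- **S2ᵛ FROM ANY SPLIT WINDOW (PROVED; the cell representation `ρH` is ARBITRARY).**  For a continuous
`π : H →* G` of compact `H` with finite kernel, a split window `W` for `ker π`, ANY faithful unitary `ρH` of `H` and
`r` of `G`: there is `c` with `c(β) β → ∞` such that for every `β ≥ 1` the weight `w = E_β · W` satisfies all seven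
clauses of `TwistSplitWeight π ρH r (c β) β w`.  (Specialisation with `W = window ρH N` below.)

ORIGINAL DOCSTRING of the specialisation: **S2ᵛ AT A CYCLIC-SCALAR COVER DATUM (PROVED).**  For a continuous `π : H →* G` of compact `H` with finite kernel
`ker π = ⟨k₀⟩` of order `N > 0` on which the faithful unitary `ρH` is scalar (`ρH k₀ = ω • 1`, `ω` a primitive `N`-th
root of unity, `0 < dim ρH`), and any faithful unitary `r` of `G`: there is `c : ℝ → ℝ` with `c(β) β → ∞` such that for
every `β ≥ 1` the Schur–Fejér weight `w = E_β · W_N` satisfies ALL SEVEN clauses of `TwistSplitWeight π ρH r (c β) β w`.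
No Lie / simplicity hypothesis is used. -/
theorem splitVanishingAt_of_window [IsTopologicalGroup H] [CompactSpace H] [MeasurableSpace H]
    [BorelSpace H] (π : H →* G) (hπ : Continuous π) (hfin : (π.ker : Set H).Finite)
    {W : H → ℝ} (hW : IsSplitWindow π.ker W) (ρH : LatticeRep H) (r : LatticeRep G) :
    ∃ c : ℝ → ℝ, Tendsto (fun β => c β * β) atTop atTop ∧ ∃ β_s : ℝ, ∀ β : ℝ, β_s ≤ β →
      ∃ w : H → ℝ, TwistSplitWeight π ρH r (c β) β w := by
  classical
  set μ : Measure H := haarProbability H with hμ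
  haveI hprob : IsProbabilityMeasure μ :=
    ⟨by simpa [hμ, haarProbability] using Measure.haarMeasure_self (G := H) (K₀ := ⊤)⟩
  haveI : μ.IsOpenPosMeasure := by
    rw [hμ]
    unfold haarProbability
    infer_instance
  haveI : Nonempty H := ⟨1⟩
  -- the potential `F = Re tr r ∘ π`, the finite set `S = ker π ∖ {1}`
  set F : H → ℝ := fun h => (r.ρ (π h)).trace.re with hF
  have hFc : Continuous F := (continuous_reTrace r).comp hπ
  set S : Finset H := hfin.toFinset.erase 1 with hS
  have hSmem : ∀ {k : H}, k ∈ S ↔ k ∈ π.ker ∧ k ≠ 1 := fun {k} => by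
    rw [hS, Finset.mem_erase, hfin.mem_toFinset, SetLike.mem_coe, and_comm]
  -- the cutoff factors
  set δ : H → ℝ := fun k => (ρH.N : ℝ) - (ρH.ρ k).trace.re with hδ
  have hδpos : ∀ k ∈ S, 0 < δ k := fun k hk => by
    have := reTrace_lt_of_ne_one ρH (hSmem.1 hk).2
    show 0 < (ρH.N : ℝ) - (ρH.ρ k).trace.re
    linarith
  set u : H → H → ℝ := fun k h => (ρH.ρ h).trace.re - (ρH.ρ (k⁻¹ * h)).trace.re with hu
  have huc : ∀ k, Continuous (u k) := fun k =>
    (continuous_reTrace ρH).sub ((continuous_reTrace ρH).comp (continuous_const.mul continuous_id))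
  set σ : H → ℝ → ℝ := fun k t => min 1 (max 0 (1 + t / δ k)) with hσ
  have hσc : ∀ k, Continuous (σ k) := fun k =>
    continuous_const.min (continuous_const.max (continuous_const.add (continuous_id.div_const _)))
  have hσ01 : ∀ k t, 0 ≤ σ k t ∧ σ k t ≤ 1 := fun k t =>
    ⟨le_min zero_le_one (le_max_left _ _), min_le_left _ _⟩
  set φ : H → ℝ := fun h => ∏ k ∈ S, σ k (u k h) with hφ
  have hφc : Continuous φ := continuous_finsetProd S fun k _ => (hσc k).comp (huc k)
  have hφnn : ∀ h, 0 ≤ φ h := fun h => Finset.prod_nonneg fun k _ => (hσ01 k _).1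
  have hφC : ∀ h : H, (∀ k' : H, k' ∈ π.ker → k' ≠ 1 →
      (ρH.ρ (k'⁻¹ * h)).trace.re < (ρH.ρ h).trace.re) → φ h = 1 := by
    intro h hh
    refine Finset.prod_eq_one fun k hk => ?_
    have hpos : 0 < u k h := by
      have := hh k (hSmem.1 hk).1 (hSmem.1 hk).2
      show 0 < (ρH.ρ h).trace.re - (ρH.ρ (k⁻¹ * h)).trace.re
      linarith
    have h1 : 1 ≤ 1 + u k h / δ k := le_add_of_nonneg_right (div_nonneg hpos.le (hδpos k hk).le)
    show min 1 (max 0 (1 + u k h / δ k)) = 1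
    exact min_eq_left (h1.trans (le_max_right _ _))
  have hφker : ∀ k ∈ S, φ k = 0 := by
    intro k hk
    refine Finset.prod_eq_zero hk ?_
    have hu1 : u k k = -δ k := by
      show (ρH.ρ k).trace.re - (ρH.ρ (k⁻¹ * k)).trace.re = -((ρH.N : ℝ) - (ρH.ρ k).trace.re)
      rw [inv_mul_cancel, reTrace_one]
      ring
    show min 1 (max 0 (1 + u k k / δ k)) = 0
    rw [hu1, neg_div, div_self (hδpos k hk).ne', add_neg_cancel, max_self,
      min_eq_right zero_le_one]
  -- the dominating continuous defect `f̃ = (1 − W) φ`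
  set ft : H → ℝ := fun h => (1 - W h) * φ h with hft
  have hftc : Continuous ft := (continuous_const.sub (hW.continuous)).mul hφc
  have hft0 : ∀ h, 0 ≤ ft h := fun h => mul_nonneg (sub_nonneg.2 (hW.le_one h)) (hφnn h)
  have hftz : ∀ x, (∀ y, F y ≤ F x) → ft x = 0 := by
    intro x hx
    have hxker : x ∈ π.ker := mem_ker_of_isMax_reTrace π r hx
    by_cases hx1 : x = 1
    · show (1 - W x) * φ x = 0
      rw [hx1, hW.one, sub_self, zero_mul]
    · show (1 - W x) * φ x = 0
      rw [hφker x (hSmem.2 ⟨hxker, hx1⟩), mul_zero]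
  -- Laplace: q(β) = |ker π| ∫ E_β f̃ / ∫ E_β → 0
  have hL := laplace_ratio_tendsto_zero μ hFc hftc hft0 hftz
  set T : ℝ := (hfin.toFinset.card : ℝ) with hT
  set q : ℝ → ℝ := fun β => T * ((∫ x, Real.exp (β * F x) * ft x ∂μ) / ∫ x, Real.exp (β * F x) ∂μ)
    with hq
  have hq0 : Tendsto q atTop (𝓝 0) := by simpa [hq] using hL.const_mul T
  -- the rate function
  set t : ℝ → ℝ := fun β => if 0 < q β then min β (-Real.log (q β)) else β with htdef
  refine ⟨fun β => t β / β, ?_, 1, fun β hβ => ?_⟩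
  · -- `c(β) β = t(β) → ∞`
    have hct : (fun β : ℝ => t β / β * β) =ᶠ[atTop] t := by
      filter_upwards [eventually_gt_atTop (0 : ℝ)] with β hβ
      exact div_mul_cancel₀ (t β) hβ.ne'
    refine (tendsto_atTop.2 fun A => ?_).congr' hct.symm
    have h1 : ∀ᶠ β : ℝ in atTop, q β < Real.exp (-A) := hq0.eventually (gt_mem_nhds (Real.exp_pos _))
    filter_upwards [h1, eventually_ge_atTop A] with β hqβ hβA
    show A ≤ (if 0 < q β then min β (-Real.log (q β)) else β)
    split_ifs with hpos
    · refine le_min hβA ?_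
      have := Real.log_lt_log hpos hqβ
      rw [Real.log_exp] at this
      linarith
    · exact hβA
  · -- for `β ≥ 1`: all seven clauses for `w = E_β W_N`
    have hβ0 : 0 < β := by linarith
    refine ⟨splitWOf π r W β, twistSplitWeight_of_window π hπ hW ρH r hβ0.le (t β / β) ?_⟩
    rw [div_mul_cancel₀ (t β) hβ0.ne']
    -- integrability and positivity
    have hEc : Continuous fun h => Real.exp (β * F h) := (hFc.const_mul β).rexp
    have hEi : Integrable (fun h => Real.exp (β * F h)) μ :=
      hEc.integrable_of_hasCompactSupport (HasCompactSupport.of_compactSpace _)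
    have hEfi : Integrable (fun h => Real.exp (β * F h) * ft h) μ :=
      (hEc.mul hftc).integrable_of_hasCompactSupport (HasCompactSupport.of_compactSpace _)
    have hEpos : 0 < ∫ h, Real.exp (β * F h) ∂μ := integral_exp_pos hEi
    have hw0 : ∀ h, 0 ≤ splitWOf π r W β h := fun h =>
      mul_nonneg (blind_pos π r β h).le (hW.nonneg h)
    have hwint : 0 ≤ ∫ h, splitWOf π r W β h ∂μ := integral_nonneg hw0
    -- (5c) mass identity, read as `∫ E = T ∫ w`
    have hmass : ∫ h, Real.exp (β * F h) ∂μ = T * ∫ h, splitWOf π r W β h ∂μ :=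
      integral_blind_eq_card_mul_integral_splitWOf π hπ hfin hW r β
    -- (5d) domination of the wrong-cell defect
    have hCeq : {h : H | (∀ k' : H, k' ∈ π.ker → k' ≠ 1 →
        (ρH.ρ (k'⁻¹ * h)).trace.re < (ρH.ρ h).trace.re)} = ⋂ k ∈ S, {h | 0 < u k h} := by
      ext h
      simp only [Set.mem_setOf_eq, Set.mem_iInter]
      constructor
      · intro hh k hk
        have := hh k (hSmem.1 hk).1 (hSmem.1 hk).2
        show 0 < (ρH.ρ h).trace.re - (ρH.ρ (k⁻¹ * h)).trace.re
        linarith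
      · intro hh k hk hk1
        have := hh k (hSmem.2 ⟨hk, hk1⟩)
        change 0 < (ρH.ρ h).trace.re - (ρH.ρ (k⁻¹ * h)).trace.re at this
        linarith
    have hCopen : IsOpen {h : H | (∀ k' : H, k' ∈ π.ker → k' ≠ 1 →
        (ρH.ρ (k'⁻¹ * h)).trace.re < (ρH.ρ h).trace.re)} := by
      rw [hCeq]
      exact isOpen_biInter_finset fun k _ => isOpen_lt continuous_const (huc k)
    have hdom : ∫ h in {h : H | (∀ k' : H, k' ∈ π.ker → k' ≠ 1 →
        (ρH.ρ (k'⁻¹ * h)).trace.re < (ρH.ρ h).trace.re)},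
        (Real.exp (β * (r.ρ (π h)).trace.re) - splitWOf π r W β h) ∂μ ≤
        ∫ h, Real.exp (β * F h) * ft h ∂μ := by
      calc ∫ h in {h : H | (∀ k' : H, k' ∈ π.ker → k' ≠ 1 →
            (ρH.ρ (k'⁻¹ * h)).trace.re < (ρH.ρ h).trace.re)},
            (Real.exp (β * (r.ρ (π h)).trace.re) - splitWOf π r W β h) ∂μ
          = ∫ h in {h : H | (∀ k' : H, k' ∈ π.ker → k' ≠ 1 →
            (ρH.ρ (k'⁻¹ * h)).trace.re < (ρH.ρ h).trace.re)}, Real.exp (β * F h) * ft h ∂μ := by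
            refine setIntegral_congr_fun hCopen.measurableSet fun h hh => ?_
            show Real.exp (β * (r.ρ (π h)).trace.re) - blind π r β h * W h =
              Real.exp (β * (r.ρ (π h)).trace.re) * ((1 - W h) * φ h)
            rw [hφC h hh]
            unfold blind
            ring
        _ ≤ ∫ h, Real.exp (β * F h) * ft h ∂μ :=
            setIntegral_le_integral hEfi (Eventually.of_forall fun h =>
              mul_nonneg (Real.exp_pos _).le (hft0 h))
    -- `∫ E f̃ = q ∫ w`
    have hEft : ∫ h, Real.exp (β * F h) * ft h ∂μ = q β * ∫ h, splitWOf π r W β h ∂μ := by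
      show _ = T * ((∫ x, Real.exp (β * F x) * ft x ∂μ) / ∫ x, Real.exp (β * F x) ∂μ) * _
      rw [mul_assoc, mul_comm ((∫ x, Real.exp (β * F x) * ft x ∂μ) / ∫ x, Real.exp (β * F x) ∂μ),
        ← mul_assoc, ← hmass, mul_div_cancel₀ _ hEpos.ne']
    -- `q ≤ e^{-t}`
    have hqt : q β ≤ Real.exp (-t β) := by
      show q β ≤ Real.exp (-(if 0 < q β then min β (-Real.log (q β)) else β))
      split_ifs with hpos
      · calc q β = Real.exp (Real.log (q β)) := (Real.exp_log hpos).symm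
          _ ≤ Real.exp (-min β (-Real.log (q β))) :=
              Real.exp_le_exp.2 (by linarith [min_le_right β (-Real.log (q β))])
      · exact (not_lt.1 hpos).trans (Real.exp_pos _).le
    calc ∫ h in {h : H | (∀ k' : H, k' ∈ π.ker → k' ≠ 1 →
          (ρH.ρ (k'⁻¹ * h)).trace.re < (ρH.ρ h).trace.re)},
          (Real.exp (β * (r.ρ (π h)).trace.re) - splitWOf π r W β h) ∂μ
        ≤ q β * ∫ h, splitWOf π r W β h ∂μ := hdom.trans hEft.le
      _ ≤ Real.exp (-t β) * ∫ h, splitWOf π r W β h ∂μ :=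
          mul_le_mul_of_nonneg_right hqt hwint


/-! #### §5d Specialisations: the cyclic-scalar window (same statements as rev 5/6) and the DECOUPLED form -/

/-- (5c) **Exact mass identity**: `∫ E_β = |ker π| · ∫ E_β · W_N` at a cyclic-scalar cover datum. -/
theorem integral_blind_eq_card_mul_integral_splitW [IsTopologicalGroup H] [CompactSpace H]
    [MeasurableSpace H] [BorelSpace H] (π : H →* G) (hπ : Continuous π)
    (hfin : (π.ker : Set H).Finite) (ρH : LatticeRep H) {k₀ : H}
    (hker : π.ker = Subgroup.zpowers k₀) {N : ℕ} (hN : orderOf k₀ = N) (hNpos : 0 < N) {ω : ℂ}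
    (hω : IsPrimitiveRoot ω N) (hk₀ : ρH.ρ k₀ = ω • (1 : Matrix (Fin ρH.N) (Fin ρH.N) ℂ))
    (r : LatticeRep G) (β : ℝ) :
    ∫ h, blind π r β h ∂(haarProbability H) =
      (hfin.toFinset.card : ℝ) * ∫ h, splitW π r ρH N β h ∂(haarProbability H) := by
  haveI : (haarProbability H).IsMulLeftInvariant := by
    unfold haarProbability
    infer_instance
  have hWc := continuous_window ρH N
  have hEc := continuous_blind π r β hπ
  have hint : ∀ k : H, Integrable (fun h => blind π r β h * window ρH N (k * h))
      (haarProbability H) := fun k =>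
    (hEc.mul (hWc.comp (continuous_const.mul continuous_id))).integrable_of_hasCompactSupport
      (HasCompactSupport.of_compactSpace _)
  have hex : ∀ h, ∑ k ∈ hfin.toFinset, window ρH N (k * h) = 1 := fun h => by
    rw [← finsum_mem_eq_finite_toFinset_sum (fun k => window ρH N (k * h)) hfin]
    exact window_exact ρH π.ker hker hN hNpos hω hk₀ h
  have htr : ∀ k ∈ hfin.toFinset, ∫ h, blind π r β h * window ρH N (k * h) ∂(haarProbability H) =
      ∫ h, splitW π r ρH N β h ∂(haarProbability H) := by
    intro k hk
    have hk' : k ∈ π.ker := SetLike.mem_coe.1 (hfin.mem_toFinset.1 hk)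
    have e : (fun h => blind π r β h * window ρH N (k * h)) = fun h => splitW π r ρH N β (k * h) :=
      funext fun h => by
        unfold splitW
        rw [blind_kernel_mul π r β hk']
    rw [e]
    exact integral_mul_left_eq_self (fun x => splitW π r ρH N β x) k
  calc ∫ h, blind π r β h ∂(haarProbability H)
      = ∫ h, ∑ k ∈ hfin.toFinset, blind π r β h * window ρH N (k * h) ∂(haarProbability H) := by
        congr 1
        funext h
        rw [← Finset.mul_sum, hex h, mul_one]
    _ = ∑ k ∈ hfin.toFinset, ∫ h, blind π r β h * window ρH N (k * h) ∂(haarProbability H) :=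
        integral_finsetSum _ fun k _ => hint k
    _ = ∑ k ∈ hfin.toFinset, ∫ h, splitW π r ρH N β h ∂(haarProbability H) :=
        Finset.sum_congr rfl htr
    _ = (hfin.toFinset.card : ℝ) * ∫ h, splitW π r ρH N β h ∂(haarProbability H) := by
        rw [Finset.sum_const, nsmul_eq_mul]

/-- **S2ᵛ WITH THE WINDOW REPRESENTATION DECOUPLED (PROVED).**  If `ker π = ⟨k₀⟩` is cyclic of order `N > 0` and SOME
faithful unitary `ρW` of `H` is scalar on it (`ρW k₀ = ω • 1`, `ω` primitive, `0 < dim ρW` — e.g. the defining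
representation of `SU(N)` for `SU(N) → SU(N)/Z_m`, a spin representation for `Spin → SO`), then S2ᵛ holds at `(π, ρH, r)`
for EVERY faithful unitary `ρH` (the cell representation of the stub) and every faithful unitary `r`. -/
theorem splitVanishingAt_cyclic_decoupled [IsTopologicalGroup H] [CompactSpace H] [MeasurableSpace H]
    [BorelSpace H] (π : H →* G) (hπ : Continuous π) (hfin : (π.ker : Set H).Finite)
    (ρW : LatticeRep H) (hdW : 0 < ρW.N) {k₀ : H} (hker : π.ker = Subgroup.zpowers k₀) {N : ℕ}
    (hN : orderOf k₀ = N) (hNpos : 0 < N) {ω : ℂ} (hω : IsPrimitiveRoot ω N)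
    (hk₀ : ρW.ρ k₀ = ω • (1 : Matrix (Fin ρW.N) (Fin ρW.N) ℂ)) (ρH : LatticeRep H) (r : LatticeRep G) :
    ∃ c : ℝ → ℝ, Tendsto (fun β => c β * β) atTop atTop ∧ ∃ β_s : ℝ, ∀ β : ℝ, β_s ≤ β →
      ∃ w : H → ℝ, TwistSplitWeight π ρH r (c β) β w :=
  splitVanishingAt_of_window π hπ hfin (isSplitWindow_window ρW hdW π.ker hker hN hNpos hω hk₀) ρH r

/-- **S2ᵛ AT A CYCLIC-SCALAR COVER DATUM (PROVED)** — the rev-5 statement, now the case `ρW = ρH` of the decoupled form. -/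
theorem splitVanishingAt_cyclic [IsTopologicalGroup H] [CompactSpace H] [MeasurableSpace H]
    [BorelSpace H] (π : H →* G) (hπ : Continuous π) (hfin : (π.ker : Set H).Finite)
    (ρH : LatticeRep H) (hd : 0 < ρH.N) {k₀ : H} (hker : π.ker = Subgroup.zpowers k₀) {N : ℕ}
    (hN : orderOf k₀ = N) (hNpos : 0 < N) {ω : ℂ} (hω : IsPrimitiveRoot ω N)
    (hk₀ : ρH.ρ k₀ = ω • (1 : Matrix (Fin ρH.N) (Fin ρH.N) ℂ)) (r : LatticeRep G) :
    ∃ c : ℝ → ℝ, Tendsto (fun β => c β * β) atTop atTop ∧ ∃ β_s : ℝ, ∀ β : ℝ, β_s ≤ β →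
      ∃ w : H → ℝ, TwistSplitWeight π ρH r (c β) β w :=
  splitVanishingAt_cyclic_decoupled π hπ hfin ρH hd hker hN hNpos hω hk₀ ρH r


end Laplace

end Summit.QuantumFields.YangMills.Cruxes.IRcof.EquipartitionSeam.SchurFejer

end
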